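import Literature.Topology.FourManifolds.SlideSetup1
import HarnessLib

/-!
# The slide set-up, II: the twist, the axis and the route hypotheses of the lower track

Topic `Literature/Topology/FourManifolds`; fact seat `provefact-IsStrictHandleSlide.isSurgery`
(R. C. Kirby, *The Topology of 4-Manifolds*, LNM 1374 (1989), Ch. I §4, Fig. 4.2; remaining content:
the named fact (S) `Literature.Topology.FourManifolds.FramedLink.IsStrictHandleSlide.slideModel`).
From a `SlideChoice` (part I): the tip radii `r_D = 1 + κ_D e h_D`, `r_Dᵘ`, the separation
`S = ΘB h_D - ΘB h_Dᵘ`, the twist `tw = twistOf r_D r_Dᵘ S` (`TwistChoice.lean`), the tip angles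
`θ_D, θ_Dᵘ ∈ [θ_low, π - θ_low]`, the axis `φ = ΘB h_D - θ_D` and the slice angles
`Θlo = ΘB - φ`, `Θup = φ - ΘB (1 - ·)`; and the **`RouteHyp` of the lower track**
(`BandCore.SlideChoice.routeHypLo`), all its conditions being consequences of the fields of the
`SlideChoice` through `|tw| ≤ cmax` (`SlideTipMargins.abs_twist_le_cmax`).

## References

* R. C. Kirby, *The Topology of 4-Manifolds*, LNM 1374, Springer (1989), Ch. I §4. [Kirby1989]
-/

open scoped Topology ContDiff
open Set Real Filter

noncomputable section

namespace Literature.Topology.FourManifolds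

namespace BandCore

variable {A B : Knot} {avoid : Set (Metric.sphere (0 : EuclideanSpace ℝ (Fin 4)) 1)} {c : BandCore A B avoid}

/-! ### Smoothness and Lipschitz bound of the slice angle -/

/-- `ΘB` is `C^∞` on the open window. [folklore] -/
theorem contDiffOn_ΘB (c : BandCore A B avoid) : ContDiffOn ℝ ∞ c.ΘB (Ioo (10⁻¹ : ℝ) (9 / 10)) := by
  have : c.ΘB = fun y ↦ 2 * π * c.thetaB y := rfl
  rw [this]; exact contDiffOn_const.mul c.contDiffOn_thetaB

namespace SlideChoice

variable {e : ℝ → ℝ} (P : c.SlideChoice e)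

/-- `MΘ_pos` (auxiliary). [folklore] -/
theorem MΘ_pos : 0 < P.MΘ := by
  have h := P.Θ_deriv 0.5 (by norm_num); linarith [P.mΘ_pos, h.1, h.2]

/-- `emin_le_emax` (auxiliary). [folklore] -/
theorem emin_le_emax : P.emin ≤ P.emax := by
  have h := P.e_bounds 0.5 (by norm_num); exact h.1.trans h.2

/-- `emax_pos` (auxiliary). [folklore] -/
theorem emax_pos : 0 < P.emax := P.emin_pos.trans_le P.emin_le_emax

/-- `Me_nonneg` (auxiliary). [folklore] -/
theorem Me_nonneg : 0 ≤ P.Me := (abs_nonneg _).trans (P.e_deriv 0.5 (by norm_num))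

/-- `κD_le_one` (auxiliary). [folklore] -/
theorem κD_le_one : P.κD ≤ 1 := by
  have h := P.κD_e; have := P.emin_le_emax; have := P.κD_pos
  by_contra hc; nlinarith [lt_of_not_ge hc, P.emin_pos]

/-- `|ΘB x - ΘB y| ≤ MΘ |x - y|` on `[0.12, 0.88]`. [folklore] -/
theorem abs_ΘB_sub_le {x y : ℝ} (hx : x ∈ Icc (0.12 : ℝ) 0.88) (hy : y ∈ Icc (0.12 : ℝ) 0.88) :
    |c.ΘB x - c.ΘB y| ≤ P.MΘ * |x - y| := by
  have hsub : Icc (0.12 : ℝ) 0.88 ⊆ Ioo (10⁻¹ : ℝ) (9 / 10) := fun h hh ↦ ⟨by linarith [hh.1], by linarith [hh.2]⟩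
  have h := Convex.norm_image_sub_le_of_norm_deriv_le (f := c.ΘB) (s := Icc (0.12 : ℝ) 0.88) (C := P.MΘ)
    (fun z hz ↦ ((contDiffOn_ΘB c).differentiableOn (by simp)).differentiableAt (Ioo_mem_nhds (hsub hz).1 (hsub hz).2))
    (fun z hz ↦ by
      rw [Real.norm_eq_abs, abs_le]
      have := P.Θ_deriv z hz; exact ⟨this.1, by linarith [this.2, P.mΘ_pos]⟩) (convex_Icc _ _) hy hx
  simpa [Real.norm_eq_abs] using h

/-! ### The tips, the twist and the axis -/

/-- `hD_win` (auxiliary). [folklore] -/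
theorem hD_win : P.hD ∈ Icc (0.12 : ℝ) 0.88 := ⟨by linarith [P.hD_mem'.1], by linarith [P.hD_mem'.2]⟩
/-- `hDu_win` (auxiliary). [folklore] -/
theorem hDu_win : P.hDu ∈ Icc (0.12 : ℝ) 0.88 := ⟨by linarith [P.hDu_mem'.1], by linarith [P.hDu_mem'.2]⟩

/-- **The lower tip radius** `r_D = 1 + κ_D e h_D`. [folklore] -/
def rD : ℝ := 1 + P.κD * e P.hD

/-- **The upper tip radius** `r_Dᵘ = 1 + κ_D e h_Dᵘ`. [folklore] -/
def rDu : ℝ := 1 + P.κD * e P.hDu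

/-- `rD_mem` (auxiliary). [folklore] -/
theorem rD_mem : P.rD ∈ Icc (1 : ℝ) 2 := by
  have he := P.e_bounds _ P.hD_win
  rw [rD]; constructor <;> nlinarith [P.κD_pos, P.emin_pos, he.1, he.2, P.κD_e']

/-- `rDu_mem` (auxiliary). [folklore] -/
theorem rDu_mem : P.rDu ∈ Icc (1 : ℝ) 2 := by
  have he := P.e_bounds _ P.hDu_win
  rw [rDu]; constructor <;> nlinarith [P.κD_pos, P.emin_pos, he.1, he.2, P.κD_e']

/-- `rD_pos` (auxiliary). [folklore] -/
theorem rD_pos : 0 < P.rD := by linarith [P.rD_mem.1]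
/-- `rDu_pos` (auxiliary). [folklore] -/
theorem rDu_pos : 0 < P.rDu := by linarith [P.rDu_mem.1]

/-- **The separation of the tips.** [folklore] -/
def S : ℝ := c.ΘB P.hD - c.ΘB P.hDu

/-- `S_mem` (auxiliary). [folklore] -/
theorem S_mem : P.S ∈ Ioo 0 (2 * π) := c.tipSep_mem_Ioo P.hD_mem' P.hDu_mem'

/-- **The twist of the slide.** [folklore] -/
def tw : ℝ := twistOf P.rD P.rDu P.S P.rD_pos P.rDu_pos P.S_mem

/-- **The lower tip angle.** [folklore] -/
def θD : ℝ := 2 * arctan (exp (-(P.tw * P.rD)))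

/-- **The upper tip angle.** [folklore] -/
def θDu : ℝ := P.S - P.θD

/-- **The axis angle.** [folklore] -/
def φ : ℝ := c.ΘB P.hD - P.θD

/-- **The slice angle of the lower side**, `ΘB - φ`. [folklore] -/
def Θlo (h : ℝ) : ℝ := c.ΘB h - P.φ

/-- **The slice angle of the upper side in reflected height**, `φ - ΘB (1 - ·)`. [folklore] -/
def Θup (h : ℝ) : ℝ := P.φ - c.ΘB (1 - h)

/-- `tipSum_tw` (auxiliary). [folklore] -/
theorem tipSum_tw : tipSum P.rD P.rDu P.tw = P.S := tipSum_twistOf P.rD_pos P.rDu_pos P.S_mem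

/-- `abs_tw_le` (auxiliary). [folklore] -/
theorem abs_tw_le : |P.tw| ≤ c.cmax := c.abs_twist_le_cmax P.hD_mem' P.hDu_mem' P.rD_mem P.rDu_mem P.tipSum_tw

/-- The two tip conditions and the ranges of the tip angles. [folklore] -/
theorem tip_lo : exp (P.tw * P.rD) * tan (P.θD / 2) = 1 := (tip_conditions P.rD_pos P.rDu_pos P.S_mem).1

/-- `tip_up` (auxiliary). [folklore] -/
theorem tip_up : exp (P.tw * P.rDu) * tan (P.θDu / 2) = 1 := (tip_conditions P.rD_pos P.rDu_pos P.S_mem).2.1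

/-- `θDu_eq` (auxiliary). [folklore] -/
theorem θDu_eq : P.θDu = 2 * arctan (exp (-(P.tw * P.rDu))) := by
  have h := P.tipSum_tw; rw [tipSum] at h; rw [θDu, θD]; linarith

/-- A tip angle `2 arctan (e^{-tw r})` with `|tw| ≤ cmax`, `r ∈ [1,2]` lies in `[θ_low, π - θ_low]`. [folklore] -/
theorem tipAngle_mem {r : ℝ} (hr : r ∈ Icc (1 : ℝ) 2) : 2 * arctan (exp (-(P.tw * r))) ∈ Icc c.θlow (π - c.θlow) := by
  have htw := abs_le.1 P.abs_tw_le
  have h1 : -(2 * c.cmax) ≤ -(P.tw * r) := by nlinarith [hr.1, hr.2, htw.1, htw.2, c.cmax_nonneg]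
  have h2 : -(P.tw * r) ≤ 2 * c.cmax := by nlinarith [hr.1, hr.2, htw.1, htw.2, c.cmax_nonneg]
  constructor
  · rw [θlow]
    have := arctan_strictMono.monotone (exp_le_exp.2 h1); linarith
  · -- `2 arctan (e^{x}) ≤ π - 2 arctan (e^{-2cmax})` for `x ≤ 2 cmax`, via `arctan (1/u) = π/2 - arctan u`
    have hmono := arctan_strictMono.monotone (exp_le_exp.2 h2)
    have hinv : arctan (exp (2 * c.cmax)) = π / 2 - arctan (exp (-(2 * c.cmax))) := by
      rw [← arctan_inv_of_pos (exp_pos (-(2 * c.cmax))), ← exp_neg, neg_neg]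
    rw [θlow]; linarith

/-- `θD_mem` (auxiliary). [folklore] -/
theorem θD_mem : P.θD ∈ Icc c.θlow (π - c.θlow) := P.tipAngle_mem P.rD_mem

/-- `θDu_mem` (auxiliary). [folklore] -/
theorem θDu_mem : P.θDu ∈ Icc c.θlow (π - c.θlow) := by rw [P.θDu_eq]; exact P.tipAngle_mem P.rDu_mem

/-- `Θlo_hD` (auxiliary). [folklore] -/
theorem Θlo_hD : P.Θlo P.hD = P.θD := by rw [Θlo, φ]; ring

/-- `Θup_hDu'` (auxiliary). [folklore] -/
theorem Θup_hDu' : P.Θup (P.du.Hh P.du.tD) = P.θDu := by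
  rw [Θup, φ, θDu, S]
  have : 1 - P.du.Hh P.du.tD = P.hDu := rfl
  rw [this]; ring

/-! ### The route hypotheses of the lower track -/

/-- The monotonicity of the route conditions in the twist: `q₊(tw) ≤ qmaxc`. [folklore] -/
theorem qmax_le : exp (|P.tw| * 2) / cos ((π - c.θlow / 2) / 2) ^ 2 ≤ c.qmaxc := by
  have hcos : cos ((π - c.θlow / 2) / 2) = sin (c.θlow / 4) := by
    rw [show (π - c.θlow / 2) / 2 = π / 2 - c.θlow / 4 by ring, cos_pi_div_two_sub]
  rw [hcos, qmaxc]
  apply div_le_div_of_nonneg_right _ (pow_pos c.sin_θlow_quarter_pos 2).le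
  exact exp_le_exp.2 (by nlinarith [P.abs_tw_le])

/-- `qmin_ge` (auxiliary). [folklore] -/
theorem qmin_ge : c.qminc ≤ exp (-(|P.tw| * 2)) := by
  rw [qminc]; exact exp_le_exp.2 (by nlinarith [P.abs_tw_le])

variable (he : ContDiffOn ℝ ∞ e (Ioo (10⁻¹ : ℝ) (9 / 10)))

/-- The height window of the lower route hypotheses: `(hr0 - 2μ, hr1 + μ) ⊆ [0.12, 0.88]`. [folklore] -/
theorem winLo_sub {h : ℝ} (hh : h ∈ Ioo (P.dl.hr0 - 2 * P.μ) (P.dl.hr1 + P.μ)) : h ∈ Icc (0.12 : ℝ) 0.88 := by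
  have hl := P.dl_levels; have hμ := P.μ_le
  exact ⟨by linarith [hh.1], by linarith [hh.2]⟩

/-- `winLo_sub'` (auxiliary). [folklore] -/
theorem winLo_sub' {h : ℝ} (hh : h ∈ Ioo (P.dl.hr0 - 2 * P.μ) (P.dl.hr1 + P.μ)) : h ∈ Ioo (10⁻¹ : ℝ) (9 / 10) :=
  ⟨by linarith [(P.winLo_sub hh).1], by linarith [(P.winLo_sub hh).2]⟩

/-- On the window the slice angle stays within `θ_low/2` of the tip angle. [folklore] -/
theorem Θlo_mem {h : ℝ} (hh : h ∈ Ioo (P.dl.hr0 - 2 * P.μ) (P.dl.hr1 + P.μ)) :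
    P.Θlo h ∈ Icc (c.θlow / 2) (π - c.θlow / 2) := by
  have h1 := P.abs_ΘB_sub_le (P.winLo_sub hh) P.hD_win
  have hD := P.hD_mem; have hl : P.dl.hr1 = P.dl.hr0 + P.μ := by rw [dl_hr0, dl_hr1]; ring
  have hdist : |h - P.hD| ≤ 4 * P.μ := by
    rw [abs_le]; constructor <;> linarith [hh.1, hh.2, hD.1, hD.2, P.μ_pos]
  have hvar : |c.ΘB h - c.ΘB P.hD| ≤ c.θlow / 2 := by
    have := P.μ_angle
    calc |c.ΘB h - c.ΘB P.hD| ≤ P.MΘ * |h - P.hD| := h1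
      _ ≤ P.MΘ * (4 * P.μ) := mul_le_mul_of_nonneg_left hdist P.MΘ_pos.le
      _ ≤ c.θlow / 2 := by linarith
  have hθD := P.θD_mem
  have e1 : P.Θlo h = P.θD + (c.ΘB h - c.ΘB P.hD) := by rw [Θlo, φ]; ring
  rw [e1]
  have := abs_le.1 hvar
  exact ⟨by linarith [hθD.1], by linarith [hθD.2]⟩

/-! ### The route quantities with the actual twist are dominated by the band-level ones -/

/-- `dl_MH` (auxiliary). [folklore] -/
theorem dl_MH : P.dl.MH = c.liteMH := rfl
/-- `dl_vmin` (auxiliary). [folklore] -/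
theorem dl_vmin : P.dl.vmin = c.liteVmin2 P.μ_pos := rfl

/-- `routeMH'_lo_eq` (auxiliary). [folklore] -/
theorem routeMH'_lo_eq : P.dl.MH + P.dl.ms * (1 + P.CT) * (P.Mρ * c.liteMH) = routeMH' c.liteMH P.ms P.CT P.Mρ := rfl

/-- `routeMH'_lo_pos` (auxiliary). [folklore] -/
theorem routeMH'_lo_pos : 0 < routeMH' c.liteMH P.ms P.CT P.Mρ := by
  rw [routeMH']
  have := c.liteMH_pos; have := P.ms_pos; have := P.CT_nonneg; have := P.Mρ_pos
  positivity

/-- `route_K_nonneg` (auxiliary). [folklore] -/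
theorem route_K_nonneg : 0 ≤ rexp (|P.tw| * 2) / cos ((π - c.θlow / 2) / 2) ^ 2 * P.MΘ *
    (P.dl.MH + P.dl.ms * (1 + P.CT) * (P.Mρ * c.liteMH)) := by
  rw [P.routeMH'_lo_eq]
  exact mul_nonneg (mul_nonneg (div_nonneg (exp_pos _).le (sq_nonneg _)) P.MΘ_pos.le) P.routeMH'_lo_pos.le

/-- `route_K_le_lo` (auxiliary). [folklore] -/
theorem route_K_le_lo : rexp (|P.tw| * 2) / cos ((π - c.θlow / 2) / 2) ^ 2 * P.MΘ *
    (P.dl.MH + P.dl.ms * (1 + P.CT) * (P.Mρ * c.liteMH)) ≤ c.qmaxc * P.MΘ * routeMH' c.liteMH P.ms P.CT P.Mρ := by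
  rw [P.routeMH'_lo_eq]
  exact mul_le_mul_of_nonneg_right (mul_le_mul_of_nonneg_right P.qmax_le P.MΘ_pos.le) P.routeMH'_lo_pos.le

/-- `route_s_nonneg` (auxiliary). [folklore] -/
theorem route_s_nonneg : 0 ≤ |P.tw| * P.dl.κD * P.emax + rexp (|P.tw| * 2) / cos ((π - c.θlow / 2) / 2) ^ 2 * P.MΘ *
    (P.dl.MH + P.dl.ms * (1 + P.CT) * (P.Mρ * c.liteMH)) * P.dl.κD / P.dl.vmin := by
  have hκ : P.dl.κD = P.κD := rfl
  rw [hκ, dl_vmin]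
  exact add_nonneg (mul_nonneg (mul_nonneg (abs_nonneg _) P.κD_pos.le) P.emax_pos.le)
    (div_nonneg (mul_nonneg P.route_K_nonneg P.κD_pos.le) (c.liteVmin2_spec P.μ_pos).1.le)

/-- `route_s_le_lo` (auxiliary). [folklore] -/
theorem route_s_le_lo : |P.tw| * P.dl.κD * P.emax + rexp (|P.tw| * 2) / cos ((π - c.θlow / 2) / 2) ^ 2 * P.MΘ *
    (P.dl.MH + P.dl.ms * (1 + P.CT) * (P.Mρ * c.liteMH)) * P.dl.κD / P.dl.vmin ≤
    c.cmax * P.κD * P.emax + c.qmaxc * P.MΘ * routeMH' c.liteMH P.ms P.CT P.Mρ * P.κD / c.liteVmin2 P.μ_pos := by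
  have hκ : P.dl.κD = P.κD := rfl
  rw [hκ, dl_vmin]
  have hv := (c.liteVmin2_spec P.μ_pos).1
  refine add_le_add ?_ ?_
  · exact mul_le_mul_of_nonneg_right (mul_le_mul_of_nonneg_right P.abs_tw_le P.κD_pos.le) P.emax_pos.le
  · exact div_le_div_of_nonneg_right (mul_le_mul_of_nonneg_right P.route_K_le_lo P.κD_pos.le) hv.le

/-- `route_L₁_le_lo` (auxiliary). [folklore] -/
theorem route_L₁_le_lo : |P.tw| * P.emax + |P.tw| * P.dl.κD * P.Me * (P.dl.MH + P.dl.ms * (1 + P.CT) * (P.Mρ * c.liteMH)) / P.dl.vmin +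
    rexp (|P.tw| * 2) / cos ((π - c.θlow / 2) / 2) ^ 2 * P.MΘ * (P.dl.MH + P.dl.ms * (1 + P.CT) * (P.Mρ * c.liteMH)) / P.dl.vmin ≤
    c.cmax * P.emax + c.cmax * P.κD * P.Me * routeMH' c.liteMH P.ms P.CT P.Mρ / c.liteVmin2 P.μ_pos +
      c.qmaxc * P.MΘ * routeMH' c.liteMH P.ms P.CT P.Mρ / c.liteVmin2 P.μ_pos := by
  have hκ : P.dl.κD = P.κD := rfl
  have hK := P.route_K_le_lo
  rw [hκ, dl_vmin, P.routeMH'_lo_eq] at *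
  have hv := (c.liteVmin2_spec P.μ_pos).1
  have hc := P.abs_tw_le
  refine add_le_add (add_le_add ?_ ?_) ?_
  · exact mul_le_mul_of_nonneg_right hc P.emax_pos.le
  · apply div_le_div_of_nonneg_right _ hv.le
    exact mul_le_mul_of_nonneg_right (mul_le_mul_of_nonneg_right (mul_le_mul_of_nonneg_right hc P.κD_pos.le) P.Me_nonneg)
      P.routeMH'_lo_pos.le
  · exact div_le_div_of_nonneg_right hK hv.le

/-- **The route hypotheses of the lower track.** [cite: Kirby1989, Ch. I §4] -/
def routeHypLo : RouteHyp P.dl where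
  e := e
  Θ := P.Θlo
  c := P.tw
  w₁ := P.dl.hr0 - 2 * P.μ
  w₂ := P.dl.hr1 + P.μ
  emin := P.emin
  emax := P.emax
  Me := P.Me
  mΘ := P.mΘ
  MΘ := P.MΘ
  θmin := c.θlow / 2
  θmax := π - c.θlow / 2
  VX := P.Mρ * c.liteMH
  CT := P.CT
  hwin := fun τ hτ ↦ by
    have h := P.H₁_approach_lo hτ
    exact ⟨by linarith [h.1, P.μ_pos], by linarith [h.2, P.μ_pos]⟩
  e_smooth := he.mono fun h hh ↦ P.winLo_sub' hh
  Θ_smooth := ((contDiffOn_ΘB c).sub contDiffOn_const).mono fun h hh ↦ P.winLo_sub' hh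
  e_bounds := fun h hh ↦ P.e_bounds h (P.winLo_sub hh)
  emin_pos := P.emin_pos
  e_deriv := fun h hh ↦ P.e_deriv h (P.winLo_sub hh)
  Θ_deriv := fun h hh ↦ by
    have hd : deriv P.Θlo h = deriv c.ΘB h := by
      have : P.Θlo = fun y ↦ c.ΘB y - P.φ := rfl
      rw [this, deriv_sub_const]
    rw [hd]; exact P.Θ_deriv h (P.winLo_sub hh)
  mΘ_pos := P.mΘ_pos
  Θ_mem := fun h hh ↦ P.Θlo_mem hh
  θmin_pos := by linarith [c.θlow_pos]
  θmax_lt := by linarith [c.θlow_pos]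
  tip := by
    show exp (P.tw * (1 + P.κD * e (P.dl.Hh P.dl.tD))) * tan (P.Θlo (P.dl.Hh P.dl.tD) / 2) = 1
    have : P.dl.Hh P.dl.tD = P.hD := rfl
    rw [this, P.Θlo_hD]; exact P.tip_lo
  VX_ge := fun τ hτ ↦ by
    have h := P.dl.deriv_Xl_le P.CT_ge (τ := τ) ⟨hτ.1, by linarith [hτ.2, P.dl.ε_pos]⟩
    have hM : P.dl.Mρ_of P.CT ≤ P.Mρ := P.Mρ_geₗ
    have hMH : P.dl.MH = c.liteMH := rfl
    rw [hMH] at h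
    exact h.trans (mul_le_mul_of_nonneg_right hM c.liteMH_pos.le)
  CT_ge := P.CT_ge
  CT_nonneg := P.CT_nonneg
  u₁_half := P.two_u₁_le
  cond0 := P.κD_e'
  cond1 := P.cond1ₗ
  cond2 := by
    have hs := P.route_s_le_lo
    have hc := P.abs_tw_le
    have h0 : 0 ≤ |P.tw| * P.dl.κD * P.emax + rexp (|P.tw| * 2) / cos ((π - c.θlow / 2) / 2) ^ 2 * P.MΘ *
        (P.dl.MH + P.dl.ms * (1 + P.CT) * (P.Mρ * c.liteMH)) * P.dl.κD / P.dl.vmin := P.route_s_nonneg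
    calc 4 * |P.tw| * _ ≤ 4 * c.cmax * (c.cmax * P.κD * P.emax +
          c.qmaxc * P.MΘ * routeMH' c.liteMH P.ms P.CT P.Mρ * P.κD / c.liteVmin2 P.μ_pos) := by
            nlinarith [abs_nonneg P.tw, c.cmax_nonneg]
      _ ≤ 1 := P.cond2ₗ
  cond3 := by
    have hs := P.route_s_le_lo
    have hK := P.route_K_le_lo
    have h0 := P.route_s_nonneg
    have hK0 : 0 ≤ rexp (|P.tw| * 2) / cos ((π - c.θlow / 2) / 2) ^ 2 * P.MΘ *
        (P.dl.MH + P.dl.ms * (1 + P.CT) * (P.Mρ * c.liteMH)) := P.route_K_nonneg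
    calc 16 * _ * _ ≤ 16 * (c.qmaxc * P.MΘ * routeMH' c.liteMH P.ms P.CT P.Mρ) *
          (c.cmax * P.κD * P.emax + c.qmaxc * P.MΘ * routeMH' c.liteMH P.ms P.CT P.Mρ * P.κD / c.liteVmin2 P.μ_pos) := by
            nlinarith [mul_le_mul hK hs h0 (P.route_K_nonneg.trans hK)]
      _ < P.dl.vmin * P.emin := P.cond3ₗ
  cond_s := P.route_s_le_lo.trans P.cond_sₗ
  cond5 := by
    have hL := P.route_L₁_le_lo
    have hq := P.qmin_ge
    have hc := P.abs_tw_le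
    have hu : P.dl.u₁ = P.κD / P.N := rfl
    have hκ : P.dl.κD = P.κD := rfl
    have hms : P.dl.ms = P.ms := rfl
    -- abbreviate the actual and the band-level loss constants
    set L := |P.tw| * P.emax + |P.tw| * P.dl.κD * P.Me * (P.dl.MH + P.dl.ms * (1 + P.CT) * (P.Mρ * c.liteMH)) / P.dl.vmin +
          rexp (|P.tw| * 2) / cos ((π - c.θlow / 2) / 2) ^ 2 * P.MΘ *
              (P.dl.MH + P.dl.ms * (1 + P.CT) * (P.Mρ * c.liteMH)) / P.dl.vmin with hLdef
    set Lc := c.cmax * P.emax + c.cmax * P.κD * P.Me * routeMH' c.liteMH P.ms P.CT P.Mρ / c.liteVmin2 P.μ_pos +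
          c.qmaxc * P.MΘ * routeMH' c.liteMH P.ms P.CT P.Mρ / c.liteVmin2 P.μ_pos with hLcdef
    rw [hu, hκ, hms]
    have h1 : P.κD / P.N * L + |P.tw| * P.κD * P.emax ≤ P.κD / P.N * Lc + c.cmax * P.κD * P.emax := by
      have a := mul_le_mul_of_nonneg_left hL (div_nonneg P.κD_pos.le P.N_pos.le)
      have b := mul_le_mul_of_nonneg_right hc (mul_nonneg P.κD_pos.le P.emax_pos.le)
      nlinarith
    have h2 : c.qminc * P.mΘ * P.ms * P.κD / 8 ≤ rexp (-(|P.tw| * 2)) * P.mΘ * P.ms * P.κD / 8 := by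
      have : 0 ≤ P.mΘ * P.ms * P.κD / 8 := by
        have := P.mΘ_pos; have := P.ms_pos; have := P.κD_pos; positivity
      nlinarith [mul_le_mul_of_nonneg_right hq this]
    have h3 := P.cond5ₗ
    linarith

/-! ### The upper window -/

/-- The height window of the upper route hypotheses: `(hr0ᵘ - 2μ, hr1ᵘ + μ) ⊆ [0.12, 0.88]`. [folklore] -/
theorem winUp_sub {h : ℝ} (hh : h ∈ Ioo (P.du.hr0 - 2 * P.μ) (P.du.hr1 + P.μ)) : h ∈ Icc (0.12 : ℝ) 0.88 := by
  have hl := P.du_levels; have hμ := P.μ_le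
  exact ⟨by linarith [hh.1], by linarith [hh.2]⟩

/-- `winUp_refl` (auxiliary). [folklore] -/
theorem winUp_refl {h : ℝ} (hh : h ∈ Ioo (P.du.hr0 - 2 * P.μ) (P.du.hr1 + P.μ)) : 1 - h ∈ Icc (0.12 : ℝ) 0.88 := by
  have := P.winUp_sub hh; exact ⟨by linarith [this.2], by linarith [this.1]⟩

/-- `winUp_refl'` (auxiliary). [folklore] -/
theorem winUp_refl' {h : ℝ} (hh : h ∈ Ioo (P.du.hr0 - 2 * P.μ) (P.du.hr1 + P.μ)) : 1 - h ∈ Ioo (10⁻¹ : ℝ) (9 / 10) :=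
  ⟨by linarith [(P.winUp_refl hh).1], by linarith [(P.winUp_refl hh).2]⟩

/-- `hD'_mem` (auxiliary). [folklore] -/
theorem hD'_mem : P.du.Hh P.du.tD ∈ Ioo P.du.hr0 P.du.hr1 := ⟨P.du.hr0_lt_Hh_tD, P.du.Hh_tD_lt_hr1⟩

/-- On the upper window the slice angle stays within `θ_low/2` of the upper tip angle. [folklore] -/
theorem Θup_mem {h : ℝ} (hh : h ∈ Ioo (P.du.hr0 - 2 * P.μ) (P.du.hr1 + P.μ)) :
    P.Θup h ∈ Icc (c.θlow / 2) (π - c.θlow / 2) := by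
  have h1 := P.abs_ΘB_sub_le (P.winUp_refl hh) P.hDu_win
  have hD := P.hD'_mem; have hl : P.du.hr1 = P.du.hr0 + P.μ := by rw [du_hr0, du_hr1]; ring
  have hdist : |(1 - h) - P.hDu| ≤ 4 * P.μ := by
    have e : (1 - h) - P.hDu = P.du.Hh P.du.tD - h := by rw [hDu]; ring
    rw [e, abs_le]; constructor <;> linarith [hh.1, hh.2, hD.1, hD.2, P.μ_pos]
  have hvar : |c.ΘB (1 - h) - c.ΘB P.hDu| ≤ c.θlow / 2 := by
    have := P.μ_angle
    calc |c.ΘB (1 - h) - c.ΘB P.hDu| ≤ P.MΘ * |(1 - h) - P.hDu| := h1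
      _ ≤ P.MΘ * (4 * P.μ) := mul_le_mul_of_nonneg_left hdist P.MΘ_pos.le
      _ ≤ c.θlow / 2 := by linarith
  have hθ := P.θDu_mem
  have e1 : P.Θup h = P.θDu - (c.ΘB (1 - h) - c.ΘB P.hDu) := by rw [Θup, θDu, S, φ]; ring
  rw [e1]
  have := abs_le.1 hvar
  exact ⟨by linarith [hθ.1], by linarith [hθ.2]⟩

/-! ### The route quantities with the actual twist are dominated by the band-level ones (upper track) -/

/-- `dl_MH` (auxiliary). [folklore] -/
theorem du_MH : P.du.MH = c.liteMHU := rfl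
/-- `du_vmin` (auxiliary). [folklore] -/
theorem du_vmin : P.du.vmin = c.liteVminU2 P.μ_pos := rfl

/-- `routeMH'_up_eq` (auxiliary). [folklore] -/
theorem routeMH'_up_eq : P.du.MH + P.du.ms * (1 + P.CT) * (P.Mρ * c.liteMHU) = routeMH' c.liteMHU P.ms P.CT P.Mρ := rfl

/-- `routeMH'_up_pos` (auxiliary). [folklore] -/
theorem routeMH'_up_pos : 0 < routeMH' c.liteMHU P.ms P.CT P.Mρ := by
  rw [routeMH']
  have := c.liteMHU_pos; have := P.ms_pos; have := P.CT_nonneg; have := P.Mρ_pos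
  positivity

/-- `route_K_nonneg_up` (auxiliary). [folklore] -/
theorem route_K_nonneg_up : 0 ≤ rexp (|P.tw| * 2) / cos ((π - c.θlow / 2) / 2) ^ 2 * P.MΘ *
    (P.du.MH + P.du.ms * (1 + P.CT) * (P.Mρ * c.liteMHU)) := by
  rw [P.routeMH'_up_eq]
  exact mul_nonneg (mul_nonneg (div_nonneg (exp_pos _).le (sq_nonneg _)) P.MΘ_pos.le) P.routeMH'_up_pos.le

/-- `route_K_le_up` (auxiliary). [folklore] -/
theorem route_K_le_up : rexp (|P.tw| * 2) / cos ((π - c.θlow / 2) / 2) ^ 2 * P.MΘ *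
    (P.du.MH + P.du.ms * (1 + P.CT) * (P.Mρ * c.liteMHU)) ≤ c.qmaxc * P.MΘ * routeMH' c.liteMHU P.ms P.CT P.Mρ := by
  rw [P.routeMH'_up_eq]
  exact mul_le_mul_of_nonneg_right (mul_le_mul_of_nonneg_right P.qmax_le P.MΘ_pos.le) P.routeMH'_up_pos.le

/-- `route_s_nonneg_up` (auxiliary). [folklore] -/
theorem route_s_nonneg_up : 0 ≤ |P.tw| * P.du.κD * P.emax + rexp (|P.tw| * 2) / cos ((π - c.θlow / 2) / 2) ^ 2 * P.MΘ *
    (P.du.MH + P.du.ms * (1 + P.CT) * (P.Mρ * c.liteMHU)) * P.du.κD / P.du.vmin := by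
  have hκ : P.du.κD = P.κD := rfl
  rw [hκ, du_vmin]
  exact add_nonneg (mul_nonneg (mul_nonneg (abs_nonneg _) P.κD_pos.le) P.emax_pos.le)
    (div_nonneg (mul_nonneg P.route_K_nonneg_up P.κD_pos.le) (c.liteVminU2_spec P.μ_pos).1.le)

/-- `route_s_le_up` (auxiliary). [folklore] -/
theorem route_s_le_up : |P.tw| * P.du.κD * P.emax + rexp (|P.tw| * 2) / cos ((π - c.θlow / 2) / 2) ^ 2 * P.MΘ *
    (P.du.MH + P.du.ms * (1 + P.CT) * (P.Mρ * c.liteMHU)) * P.du.κD / P.du.vmin ≤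
    c.cmax * P.κD * P.emax + c.qmaxc * P.MΘ * routeMH' c.liteMHU P.ms P.CT P.Mρ * P.κD / c.liteVminU2 P.μ_pos := by
  have hκ : P.du.κD = P.κD := rfl
  rw [hκ, du_vmin]
  have hv := (c.liteVminU2_spec P.μ_pos).1
  refine add_le_add ?_ ?_
  · exact mul_le_mul_of_nonneg_right (mul_le_mul_of_nonneg_right P.abs_tw_le P.κD_pos.le) P.emax_pos.le
  · exact div_le_div_of_nonneg_right (mul_le_mul_of_nonneg_right P.route_K_le_up P.κD_pos.le) hv.le

/-- `route_L₁_le_up` (auxiliary). [folklore] -/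
theorem route_L₁_le_up : |P.tw| * P.emax + |P.tw| * P.du.κD * P.Me * (P.du.MH + P.du.ms * (1 + P.CT) * (P.Mρ * c.liteMHU)) / P.du.vmin +
    rexp (|P.tw| * 2) / cos ((π - c.θlow / 2) / 2) ^ 2 * P.MΘ * (P.du.MH + P.du.ms * (1 + P.CT) * (P.Mρ * c.liteMHU)) / P.du.vmin ≤
    c.cmax * P.emax + c.cmax * P.κD * P.Me * routeMH' c.liteMHU P.ms P.CT P.Mρ / c.liteVminU2 P.μ_pos +
      c.qmaxc * P.MΘ * routeMH' c.liteMHU P.ms P.CT P.Mρ / c.liteVminU2 P.μ_pos := by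
  have hκ : P.du.κD = P.κD := rfl
  have hK := P.route_K_le_up
  rw [hκ, du_vmin, P.routeMH'_up_eq] at *
  have hv := (c.liteVminU2_spec P.μ_pos).1
  have hc := P.abs_tw_le
  refine add_le_add (add_le_add ?_ ?_) ?_
  · exact mul_le_mul_of_nonneg_right hc P.emax_pos.le
  · apply div_le_div_of_nonneg_right _ hv.le
    exact mul_le_mul_of_nonneg_right (mul_le_mul_of_nonneg_right (mul_le_mul_of_nonneg_right hc P.κD_pos.le) P.Me_nonneg)
      P.routeMH'_up_pos.le
  · exact div_le_div_of_nonneg_right hK hv.le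

/-- **The route hypotheses of the upper track** (reflected height, rate `e ∘ (1 - ·)`). [cite: Kirby1989, Ch. I §4] -/
def routeHypUp : RouteHyp P.du where
  e := fun h ↦ e (1 - h)
  Θ := P.Θup
  c := P.tw
  w₁ := P.du.hr0 - 2 * P.μ
  w₂ := P.du.hr1 + P.μ
  emin := P.emin
  emax := P.emax
  Me := P.Me
  mΘ := P.mΘ
  MΘ := P.MΘ
  θmin := c.θlow / 2
  θmax := π - c.θlow / 2
  VX := P.Mρ * c.liteMHU
  CT := P.CT
  hwin := fun τ hτ ↦ by
    have h := P.H₁_approach_up hτ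
    exact ⟨by linarith [h.1, P.μ_pos], by linarith [h.2, P.μ_pos]⟩
  e_smooth := (he.comp (contDiffOn_const.sub contDiffOn_id) fun h hh ↦ P.winUp_refl' hh)
  Θ_smooth := contDiffOn_const.sub ((contDiffOn_ΘB c).comp (contDiffOn_const.sub contDiffOn_id) fun h hh ↦ P.winUp_refl' hh)
  e_bounds := fun h hh ↦ P.e_bounds (1 - h) (P.winUp_refl hh)
  emin_pos := P.emin_pos
  e_deriv := fun h hh ↦ by
    have hr := P.winUp_refl' hh
    have hd : HasDerivAt e (deriv e (1 - h)) (1 - h) :=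
      ((he.differentiableOn (by simp)).differentiableAt (Ioo_mem_nhds hr.1 hr.2)).hasDerivAt
    have hc : HasDerivAt (fun h ↦ e (1 - h)) (deriv e (1 - h) * (0 - 1)) h :=
      hd.comp h ((hasDerivAt_const h (1:ℝ)).sub (hasDerivAt_id h))
    rw [hc.deriv, show deriv e (1 - h) * (0 - 1) = -deriv e (1 - h) by ring, abs_neg]
    exact P.e_deriv (1 - h) (P.winUp_refl hh)
  Θ_deriv := fun h hh ↦ by
    have hr := P.winUp_refl' hh
    have hd : HasDerivAt c.ΘB (deriv c.ΘB (1 - h)) (1 - h) :=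
      (((contDiffOn_ΘB c).differentiableOn (by simp)).differentiableAt (Ioo_mem_nhds hr.1 hr.2)).hasDerivAt
    have hc : HasDerivAt P.Θup (0 - deriv c.ΘB (1 - h) * (0 - 1)) h :=
      (hasDerivAt_const h P.φ).sub (hd.comp h ((hasDerivAt_const h (1:ℝ)).sub (hasDerivAt_id h)))
    rw [hc.deriv, show 0 - deriv c.ΘB (1 - h) * (0 - 1) = deriv c.ΘB (1 - h) by ring]
    exact P.Θ_deriv (1 - h) (P.winUp_refl hh)
  mΘ_pos := P.mΘ_pos
  Θ_mem := fun h hh ↦ P.Θup_mem hh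
  θmin_pos := by linarith [c.θlow_pos]
  θmax_lt := by linarith [c.θlow_pos]
  tip := by
    show exp (P.tw * (1 + P.κD * e (1 - P.du.Hh P.du.tD))) * tan (P.Θup (P.du.Hh P.du.tD) / 2) = 1
    have : 1 - P.du.Hh P.du.tD = P.hDu := rfl
    rw [P.Θup_hDu', this]; exact P.tip_up
  VX_ge := fun τ hτ ↦ by
    have h := P.du.deriv_Xl_le P.CT_ge (τ := τ) ⟨hτ.1, by linarith [hτ.2, P.du.ε_pos]⟩
    have hM : P.du.Mρ_of P.CT ≤ P.Mρ := P.Mρ_geᵤ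
    have hMH : P.du.MH = c.liteMHU := rfl
    rw [hMH] at h
    exact h.trans (mul_le_mul_of_nonneg_right hM c.liteMHU_pos.le)
  CT_ge := P.CT_ge
  CT_nonneg := P.CT_nonneg
  u₁_half := P.two_u₁_le
  cond0 := P.κD_e'
  cond1 := P.cond1ᵤ
  cond2 := by
    have hs := P.route_s_le_up
    have hc := P.abs_tw_le
    have h0 : 0 ≤ |P.tw| * P.du.κD * P.emax + rexp (|P.tw| * 2) / cos ((π - c.θlow / 2) / 2) ^ 2 * P.MΘ *
        (P.du.MH + P.du.ms * (1 + P.CT) * (P.Mρ * c.liteMHU)) * P.du.κD / P.du.vmin := P.route_s_nonneg_up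
    calc 4 * |P.tw| * _ ≤ 4 * c.cmax * (c.cmax * P.κD * P.emax +
          c.qmaxc * P.MΘ * routeMH' c.liteMHU P.ms P.CT P.Mρ * P.κD / c.liteVminU2 P.μ_pos) := by
            nlinarith [abs_nonneg P.tw, c.cmax_nonneg]
      _ ≤ 1 := P.cond2ᵤ
  cond3 := by
    have hs := P.route_s_le_up
    have hK := P.route_K_le_up
    have h0 := P.route_s_nonneg_up
    have hK0 : 0 ≤ rexp (|P.tw| * 2) / cos ((π - c.θlow / 2) / 2) ^ 2 * P.MΘ *
        (P.du.MH + P.du.ms * (1 + P.CT) * (P.Mρ * c.liteMHU)) := P.route_K_nonneg_up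
    calc 16 * _ * _ ≤ 16 * (c.qmaxc * P.MΘ * routeMH' c.liteMHU P.ms P.CT P.Mρ) *
          (c.cmax * P.κD * P.emax + c.qmaxc * P.MΘ * routeMH' c.liteMHU P.ms P.CT P.Mρ * P.κD / c.liteVminU2 P.μ_pos) := by
            nlinarith [mul_le_mul hK hs h0 (P.route_K_nonneg_up.trans hK)]
      _ < P.du.vmin * P.emin := P.cond3ᵤ
  cond_s := P.route_s_le_up.trans P.cond_sᵤ
  cond5 := by
    have hL := P.route_L₁_le_up
    have hq := P.qmin_ge
    have hc := P.abs_tw_le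
    have hu : P.du.u₁ = P.κD / P.N := rfl
    have hκ : P.du.κD = P.κD := rfl
    have hms : P.du.ms = P.ms := rfl
    -- abbreviate the actual and the band-level loss constants
    set L := |P.tw| * P.emax + |P.tw| * P.du.κD * P.Me * (P.du.MH + P.du.ms * (1 + P.CT) * (P.Mρ * c.liteMHU)) / P.du.vmin +
          rexp (|P.tw| * 2) / cos ((π - c.θlow / 2) / 2) ^ 2 * P.MΘ *
              (P.du.MH + P.du.ms * (1 + P.CT) * (P.Mρ * c.liteMHU)) / P.du.vmin with hLdef
    set Lc := c.cmax * P.emax + c.cmax * P.κD * P.Me * routeMH' c.liteMHU P.ms P.CT P.Mρ / c.liteVminU2 P.μ_pos +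
          c.qmaxc * P.MΘ * routeMH' c.liteMHU P.ms P.CT P.Mρ / c.liteVminU2 P.μ_pos with hLcdef
    rw [hu, hκ, hms]
    have h1 : P.κD / P.N * L + |P.tw| * P.κD * P.emax ≤ P.κD / P.N * Lc + c.cmax * P.κD * P.emax := by
      have a := mul_le_mul_of_nonneg_left hL (div_nonneg P.κD_pos.le P.N_pos.le)
      have b := mul_le_mul_of_nonneg_right hc (mul_nonneg P.κD_pos.le P.emax_pos.le)
      nlinarith
    have h2 : c.qminc * P.mΘ * P.ms * P.κD / 8 ≤ rexp (-(|P.tw| * 2)) * P.mΘ * P.ms * P.κD / 8 := by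
      have : 0 ≤ P.mΘ * P.ms * P.κD / 8 := by
        have := P.mΘ_pos; have := P.ms_pos; have := P.κD_pos; positivity
      nlinarith [mul_le_mul_of_nonneg_right hq this]
    have h3 := P.cond5ᵤ
    linarith

end SlideChoice

end BandCore

end Literature.Topology.FourManifolds
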